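import Mathlib
import HarnessLib
import Summits.AtomisticToContinuum.FouriersLaw.Theses.StaticAbelianSqueeze
import Literature.Barriers.AtomisticToContinuum.MazurBoundBallisticOpenChain

/-!
# Sketch (crux-ideate, stmt-AtomisticToContinuum-13416, ideator 1, round 1)
# Idea `exit-channel-dominated-convergence` — first lemmas, typed over tree objects.

Crux (FIXED): `Summit.AtomisticToContinuum.FouriersLaw.Theses.StaticAbelianSqueeze.UniformAbelianRegularity` (R).

Notation (open `N`-chain `P = pinnedChain ω₂ lam β γ`, both baths at `T`):
`J = Σ_i bondCurrent N i`, `μ_N = gibbsMeasure N T`, `P_t = transitionKernel N T T t`,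
`corr f g t = ∫ f · (P_t g) dμ_N`, `c_N = corr J J`,
`b = (γ/2)(p²_{N-1} - p²_0)` (bath kinetic-temperature imbalance),
`X̃ = energyMoment - ((N-1)/2)·H` (centred energy dipole), so that `L X̃ = J - (N-1)·b` at `T_L = T_R`
(`poisson_hamiltonian_energyMoment` + `generator_hamiltonian_two_baths`).
Exit response `β_N(t) = corr J b t`, dipole response `K_N(t) = corr J X̃ t`.
Resolvent splitting (used on ONE side only): `F_N(ν) := ∫₀^∞ e^{-νt} c_N = ν·K̂_N(ν) + (N-1)·B_N(ν)`,
`K̂_N(ν) = ∫₀^∞ e^{-νt} K_N`, `B_N(ν) = ∫₀^∞ e^{-νt} β_N`; at `ν = 0⁺`: `T²·D_N = ∫₀^∞ β_N` (exit ledger for `J`).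
-/

noncomputable section

namespace Summit.AtomisticToContinuum.FouriersLaw.Cruxes.UniformAbelianRegularity.ExitChannel

open MeasureTheory Set
open Literature.MathematicalPhysics.KineticTheory.HeatConduction

/-- The open chain of the conjunct. -/
abbrev chain (ω₂ lam β γ : ℝ) : OscillatorChain := pinnedChain ω₂ lam β γ

/-- Total current `J = Σ_i j_i` of the `N`-chain (as in the crux). -/
def totalJ (ω₂ lam β γ : ℝ) (N : ℕ) (z : PhaseSpace N) : ℝ :=
  ∑ i : Fin N, (chain ω₂ lam β γ).bondCurrent N i z

/-- Bath kinetic-temperature imbalance `b = (γ/2)(p²_{N-1} - p²_0)` (`0` for the empty chain). -/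
def bathImbalance (γ : ℝ) (N : ℕ) (z : PhaseSpace N) : ℝ :=
  if h : 0 < N then γ / 2 * ((z.2 ⟨N - 1, by omega⟩) ^ 2 - (z.2 ⟨0, h⟩) ^ 2) else 0

/-- Centred energy dipole `X̃ = Σ_k (k - (N-1)/2) h_k` = `energyMoment - ((N-1)/2)·H`. -/
def dipole (ω₂ lam β γ : ℝ) (N : ℕ) (z : PhaseSpace N) : ℝ :=
  Literature.Barriers.AtomisticToContinuum.OpenChain.energyMoment (chain ω₂ lam β γ) N z
    - (((N : ℝ) - 1) / 2) * (chain ω₂ lam β γ).hamiltonian N z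

/-- Equilibrium time correlation `⟨f, P_t g⟩_{μ_N}` of the open chain with both baths at `T`
(the crux's inlined form, with general observables). -/
def corr (ω₂ lam β γ : ℝ) (N : ℕ) (T : ℝ) (f g : PhaseSpace N → ℝ) (t : ℝ) : ℝ :=
  ∫ z, f z * (∫ y, g y ∂((chain ω₂ lam β γ).transitionKernel N T T t.toNNReal z))
    ∂((chain ω₂ lam β γ).gibbsMeasure N T)

/-- `c_N(t) = ⟨J, P_t J⟩` — the crux's autocorrelation. -/
def autocorr (ω₂ lam β γ : ℝ) (N : ℕ) (T : ℝ) (t : ℝ) : ℝ :=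
  corr ω₂ lam β γ N T (totalJ ω₂ lam β γ N) (totalJ ω₂ lam β γ N) t

/-- EXIT RESPONSE `β_N(t) = ⟨J, P_t b⟩` — an `O(1)`-sized cross-correlation (the lever's object). -/
def exitResponse (ω₂ lam β γ : ℝ) (N : ℕ) (T : ℝ) (t : ℝ) : ℝ :=
  corr ω₂ lam β γ N T (totalJ ω₂ lam β γ N) (bathImbalance γ N) t

/-- DIPOLE RESPONSE `K_N(t) = ⟨J, P_t X̃⟩`. -/
def dipoleResponse (ω₂ lam β γ : ℝ) (N : ℕ) (T : ℝ) (t : ℝ) : ℝ :=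
  corr ω₂ lam β γ N T (totalJ ω₂ lam β γ N) (dipole ω₂ lam β γ N) t

/-- Abel transform `∫₀^∞ e^{-νt} f(t) dt`. -/
def abel (f : ℝ → ℝ) (ν : ℝ) : ℝ := ∫ t in Ioi (0:ℝ), Real.exp (-(ν * t)) * f t

/-! ## The stubs of the line, as Props (FIRST LEMMAS; nothing proved here) -/

/-- (X1) RESOLVENT SPLITTING / exit ledger for `J` (fixed `N`, `M–L`): for `ν > 0`,
`F_N(ν) = ν·K̂_N(ν) + (N-1)·B_N(ν)`, all three Abel integrands integrable, and `K_N(t) → 0`,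
`β_N ∈ L¹(0,∞)` at fixed `N` (CEHR mixing). Content: Dynkin for the polynomial observable `X̃`
under the constructed kernels + `L X̃ = J - (N-1) b` + `⟨J, X̃⟩ = 0` (momentum parity). -/
def ExitSplitting : Prop :=
  ∀ ω₂ lam β γ : ℝ, 0 < ω₂ → 0 < lam → 0 < β → 0 < γ → ∀ T : ℝ, 0 < T → ∀ N : ℕ, 2 ≤ N →
    IntegrableOn (exitResponse ω₂ lam β γ N T) (Ioi 0) ∧
    Filter.Tendsto (dipoleResponse ω₂ lam β γ N T) Filter.atTop (nhds 0) ∧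
    ∀ ν : ℝ, 0 < ν →
      IntegrableOn (fun t => Real.exp (-(ν * t)) * autocorr ω₂ lam β γ N T t) (Ioi 0) ∧
      IntegrableOn (fun t => Real.exp (-(ν * t)) * dipoleResponse ω₂ lam β γ N T t) (Ioi 0) ∧
      abel (autocorr ω₂ lam β γ N T) ν =
        ν * abel (dipoleResponse ω₂ lam β γ N T) ν + ((N : ℝ) - 1) * abel (exitResponse ω₂ lam β γ N T) ν

/-- (X0) EQUAL-TIME BOUND (= birth's `stub_equalTimeBound`, size `M`): `|c_N(t)| ≤ C·N`. -/
def EqualTimeBound : Prop :=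
  ∀ ω₂ lam β γ : ℝ, 0 < ω₂ → 0 < lam → 0 < β → 0 < γ → ∀ T : ℝ, 0 < T → ∃ C : ℝ, ∃ N₀ : ℕ,
    ∀ N : ℕ, N₀ ≤ N → ∀ t : ℝ, 0 < t → |autocorr ω₂ lam β γ N T t| ≤ C * N

/-- (X2) EXIT MAJORANT — THE LOAD-BEARING `N`-UNIFORM STATEMENT: the exit response of the open chain
has an `N`-uniform integrable majorant and converges pointwise (Cauchy in `N`, by locality) as `N → ∞`.
Physically `g(t) = A·min(1, t^{-3/2})` — the wall-return law of 1-D energy diffusion at a thermostatted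
contact; FALSE at the harmonic corner (`∫ β_N = T² D_N ∼ N`). Implies convergence of `D_N` by dominated
convergence, with NO rate and no `o(N)` accuracy. -/
def ExitMajorant : Prop :=
  ∀ ω₂ lam β γ : ℝ, 0 < ω₂ → 0 < lam → 0 < β → 0 < γ → ∀ T : ℝ, 0 < T →
    ∃ g : ℝ → ℝ, IntegrableOn g (Ioi 0) ∧ ∃ N₀ : ℕ,
      (∀ N : ℕ, N₀ ≤ N → ∀ t : ℝ, 0 < t → |exitResponse ω₂ lam β γ N T t| ≤ g t) ∧
      (∀ t : ℝ, 0 < t → ∃ ℓ : ℝ, Filter.Tendsto (fun N : ℕ => exitResponse ω₂ lam β γ N T t)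
        Filter.atTop (nhds ℓ))

/-- (X3) DIPOLE CHANNEL VANISHES PER SITE in the crux's own limit order (`ν` fixed, `N → ∞`, then `ν ↓ 0`):
`|ν·K̂_N(ν)| ≤ ε N`. After fixed-`t` matching (locality) and the crude bound `|K_N(t)| ≤ C(1+t)·N`
(from X0 + X2) it reads `∫₀^∞ e^{-νt}(C_T - β_∞) → 0`, i.e. the Abel Green–Kubo limit of the regular
pair EXISTS (item AbelRegularity-class) AND equals `∫₀^∞ β_∞`, `β_∞ := lim_N β_N` — the WALL LAW
("a uniform current kick's wall deficit is refilled entirely by the bath": complete absorption /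
recurrence of 1-D energy diffusion at one contact; an `N`-free, `κ`-free identification). -/
def DipoleChannelVanishes : Prop :=
  ∀ ω₂ lam β γ : ℝ, 0 < ω₂ → 0 < lam → 0 < β → 0 < γ → ∀ T : ℝ, 0 < T → ∀ ε : ℝ, 0 < ε →
    ∃ ν₀ : ℝ, 0 < ν₀ ∧ ∀ ν : ℝ, 0 < ν → ν < ν₀ → ∃ N₀ : ℕ, ∀ N : ℕ, N₀ ≤ N →
      |ν * abel (dipoleResponse ω₂ lam β γ N T) ν| ≤ ε * N

/-- ABSTRACT GLUE (real analysis, the dominated-convergence step; stated, to be proved in crux-plan):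
an integrable majorant makes the Abel deficits of a family uniformly small. -/
def AbelDeficitOfMajorant : Prop :=
  ∀ (g : ℝ → ℝ) (βs : ℕ → ℝ → ℝ), IntegrableOn g (Ioi 0) →
    (∀ N : ℕ, ∀ t : ℝ, 0 < t → |βs N t| ≤ g t) →
    (∀ N : ℕ, AEStronglyMeasurable (βs N) (volume.restrict (Ioi 0))) →
    ∀ ε : ℝ, 0 < ε → ∃ ν₀ : ℝ, 0 < ν₀ ∧ ∀ ν : ℝ, 0 < ν → ν < ν₀ → ∀ N : ℕ,
      |∫ t in Ioi (0:ℝ), (1 - Real.exp (-(ν * t))) * βs N t| ≤ ε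

/-- The composition the line will certify in crux-plan (stated as a Prop here, NOT proved at ideation):
`ExitSplitting → EqualTimeBound → ExitMajorant → DipoleChannelVanishes → (R)`.
Proof plan: for `c_N ∈ L¹` (else (R) is junk-true), `∫(1-e^{-νt})c_N = (N-1)∫(1-e^{-νt})β_N - ν K̂_N(ν)`
(X1 + Abelian theorem from `K_N → 0`); first term `≤ εN/2` by `AbelDeficitOfMajorant` (X2), second by X3. -/
def Composition : Prop :=
  ExitSplitting → EqualTimeBound → ExitMajorant → DipoleChannelVanishes →
    _root_.Summit.AtomisticToContinuum.FouriersLaw.Theses.StaticAbelianSqueeze.UniformAbelianRegularity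

end Summit.AtomisticToContinuum.FouriersLaw.Cruxes.UniformAbelianRegularity.ExitChannel

end
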